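import Summits.QuantumFields.BalabanUV.T4Continuum.Support.NE7StrippedConstraintRegime
import Summits.QuantumFields.BalabanUV.T4Continuum.Support.NE7StrippedConstraintSocket
import Summits.QuantumFields.BalabanUV.T4Continuum.Support.NE7FrameFreeDifferential
import HarnessLib

/-!
# NE7MultiplierStrippedIdentity — THE MULTIPLIER TERM OF THE BORDERED HESSIAN ON TOP-FRAME-FREE DIRECTIONS IS THAT OF THE STRIPPED (DOUBLE-BAR) TOWER, UNCONDITIONALLY IN THE ALL-DATA FRAME:
# `framePotW (j+1) U♯ X̃ = 0 ⟹ Dm(0)[D²𝒢(0)[X,X]] = Dm(0)[D²Ψ(0)[X,X]]`, `Ψ = strippedConstraint L N j U♯` (d = 4; lineage `b2b-balaban-t4-ne7-p1`, gen 119, file H10 = ROAD-G119 §2(d) IN KERNEL)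

Cell `pub-balaban`, rung (B)+1 sub-cell t4, CRUX PROVER NE7 #1 (OWNER of row NE7), generation 119.
ASSEMBLY of this gen's chain: H3 ✓ `NE7StrippedConstraintSocket.multiplier_transport_levelQ` (the socket: `Ψ` abstract with `Ψ0 = 0`, `C²`, `m∘G = m∘Ψ`), H6 ✓ `NE7StrippedConstraintMap` (`Ψ :=` the stripped
constraint), H9 ✓ `NE7StrippedConstraintRegime.reduced_objective_eq_stripped_of_regime` (`m∘G = m∘Ψ` near `0` from the background letters), H8 ✓ `NE7StrippedConstraintC2.contDiffAt_strippedConstraint`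
(`C²`), H7 ✓ `NE7StrippedConstraintLinearisation.hasFDerivAt_strippedConstraint` (`DΨ(0) =` the straight tower), H4 ✓ `NE7FrameFreeDifferential.levelQ'_eq_skewPR_QbarIter_of_frameFree` (on
frame-free directions the framed differential is the straight tower); the background letters are discharged for the MINIMISER from its class radius `ε·L^{-2(j+1)}` with `α₀ = 3ε` (three explicit
ε-lines displayed, as in the road's files).
WHAT ([folklore]; 0 def, 0 sorry; `d = 4`, every `U(n)`, `L ≥ 2`): **`multiplier_eq_stripped_allData`**: `∃ε₀ > 0 ∀ 0 < ε ≤ ε₀` [`C0 4·3ε ≤ 1∕3`, `12ε ≤ c2′ 4 L`, `exp(3200·25·8·3ε) ≤ 3∕2`] `∀N ≥ 1 ∃δ_V > 0 ∀j ∀V₀`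
(unitary, `N`-periodic, `δ_V`-small) `∀U♯` minimiser: (i) for ALL fine directions `X, X′` the transport identity `Dm[D²G[X,X′]] + D²m[Q′X,Q′X′] = Dm[D²Ψ[X,X′]] + D²m[DΨX, DΨX′]` with `Ψ` the
stripped constraint; (ii) for every `X` with `framePotW L (j+1) U♯ X̃ = 0`: **`Dm(0)[D²G(0)[X,X]] = Dm(0)[D²Ψ(0)[X,X]]`** — the accumulated block frames of [Balaban1985Averaging] (42) are ABSENT
from the multiplier term of ✓ p828683 on the road's slice representatives (`R₀ṽ + T_♮`, ✓ `NE7SliceRepLetters`).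
HONEST FRAMING (page 1): composition of landed kernel theorems about OUR minimisers; the bound on `Dm(0)[D²Ψ(0)[X,X]]` by scaled straight level masses (ROAD-G119 S4∕S5) is NOT here; nothing of
Bałaban's asserted ((42), (88)–(92), (97), Prop. 4∕7 context only); NOT (G′), NOT NE7 as a spine node; spine 0∕9; finite T⁴ rung (B)+1 — NOT infinite volume, NOT mass gap, NOT BetaPertH, NOT Clay.
-/

set_option autoImplicit false

open scoped BigOperators Matrix Matrix.Norms.L2Operator Topology
open NormedSpace Finset Set Filter Metric

namespace Summit.QuantumFields.BalabanUV.T4Continuum.NE7MultiplierStrippedIdentity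

open Literature.MathematicalPhysics.QuantumFieldTheory.Balaban1983to89
open B7Prop1Explicit B7Prop2Explicit
open T4AveragingDeficitWall (IsUnitaryCfg SmallField)
open T4AveragingDeficitWallBoundary (IsPeriodicCfg)
open AveragingDeficitTorusChart (TDir chart chartDir)
open AveragingDeficitTwoLevelPrep (skewSub skewPR)
open AveragingDeficitMultiLevelPrep (tower cavgIter levelQ levelQ' LevelSmall tower_ne_zero)
open AveragingDeficitMultiLevelBridge (tower_eq cavgIter_eq_avgIter)
open MinimalActionSandwich (IsMinimiser minAct)
open MinimalActionRate (sfClass)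
open NE3TangentCovariantTower (QbarIter framePotW)
open NE3.SupplierB8SfClassPrep (pdev_le_of_smallField)
open NE7MinimalOrbitDatumContinuity (thresholds)
open NE7StrippedConstraintSocket (multiplier_transport_levelQ)
open NE7StrippedConstraintMap (strippedConstraint strippedConstraint_zero)
open NE7StrippedConstraintLinearisation (qbarIterCLM qbarIterCLM_apply hasFDerivAt_strippedConstraint)
open NE7StrippedConstraintC2 (contDiffAt_strippedConstraint)
open NE7StrippedConstraintRegime (reduced_objective_eq_stripped_of_regime)
open NE7FrameFreeDifferential (levelQ'_eq_skewPR_QbarIter_of_frameFree)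

noncomputable section

variable {n : Type} [Fintype n] [DecidableEq n]

set_option maxHeartbeats 400000 in
/-- **THE MULTIPLIER TERM ON TOP-FRAME-FREE DIRECTIONS IS THAT OF THE STRIPPED TOWER** (see the module docstring). [folklore] -/
theorem multiplier_eq_stripped_allData [Nonempty n] {L : ℕ} [NeZero L] (hL : 2 ≤ L) :
    ∃ ε₀ : ℝ, 0 < ε₀ ∧ ∀ ε : ℝ, 0 < ε → ε ≤ ε₀ →
      B7Prop2Explicit.C0 4 * (3 * ε) ≤ 1 / 3 → 4 * (3 * ε) ≤ B7Prop2Explicit.c2' 4 L →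
      Real.exp (4 * (800 * (((4 : ℕ) : ℝ) + 1) ^ 2 * (((4 : ℕ) : ℝ) + 4)) * (3 * ε)) ≤ 3 / 2 →
      ∀ (N : ℕ) [NeZero N], 1 ≤ N → ∃ δV : ℝ, 0 < δV ∧ ∀ j : ℕ,
        ∀ V₀ ∈ {V : Site 4 → Fin 4 → (Matrix n n ℂ)ˣ | IsUnitaryCfg V ∧ IsPeriodicCfg V (N : ℤ) ∧ SmallField V δV},
        ∀ Us : Site 4 → Fin 4 → (Matrix n n ℂ)ˣ, IsMinimiser 4 (sfClass 4 L N ε) L N (j + 1) V₀ Us →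
          (∀ X X' : ↥(skewSub 4 n (L * tower L N j)),
            fderiv ℝ (fun y : ↥(skewSub 4 n N) => minAct 4 (sfClass 4 L N ε) L N (j + 1) (chart (ContinuousLinearMap.id ℝ (Matrix n n ℂ)) N V₀ (y : TDir 4 n N))) 0
                (fderiv ℝ (fderiv ℝ (fun Φ : ↥(skewSub 4 n (L * tower L N j)) =>
                  levelQ L N j Us (chart (ContinuousLinearMap.id ℝ (Matrix n n ℂ)) (L * tower L N j) Us (Φ : TDir 4 n (L * tower L N j))))) 0 X X')
              + fderiv ℝ (fderiv ℝ (fun y : ↥(skewSub 4 n N) => minAct 4 (sfClass 4 L N ε) L N (j + 1) (chart (ContinuousLinearMap.id ℝ (Matrix n n ℂ)) N V₀ (y : TDir 4 n N)))) 0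
                (levelQ' L N j Us (X : TDir 4 n (L * tower L N j))) (levelQ' L N j Us (X' : TDir 4 n (L * tower L N j)))
            = fderiv ℝ (fun y : ↥(skewSub 4 n N) => minAct 4 (sfClass 4 L N ε) L N (j + 1) (chart (ContinuousLinearMap.id ℝ (Matrix n n ℂ)) N V₀ (y : TDir 4 n N))) 0
                (fderiv ℝ (fderiv ℝ (strippedConstraint L N j Us)) 0 X X')
              + fderiv ℝ (fderiv ℝ (fun y : ↥(skewSub 4 n N) => minAct 4 (sfClass 4 L N ε) L N (j + 1) (chart (ContinuousLinearMap.id ℝ (Matrix n n ℂ)) N V₀ (y : TDir 4 n N)))) 0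
                (fderiv ℝ (strippedConstraint L N j Us) 0 X) (fderiv ℝ (strippedConstraint L N j Us) 0 X')) ∧
          (∀ X : ↥(skewSub 4 n (L * tower L N j)),
            framePotW L (j + 1) Us (chartDir (ContinuousLinearMap.id ℝ (Matrix n n ℂ)) (L * tower L N j) (X : TDir 4 n (L * tower L N j))) = (fun _ => 0) →
            fderiv ℝ (fun y : ↥(skewSub 4 n N) => minAct 4 (sfClass 4 L N ε) L N (j + 1) (chart (ContinuousLinearMap.id ℝ (Matrix n n ℂ)) N V₀ (y : TDir 4 n N))) 0
                (fderiv ℝ (fderiv ℝ (fun Φ : ↥(skewSub 4 n (L * tower L N j)) =>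
                  levelQ L N j Us (chart (ContinuousLinearMap.id ℝ (Matrix n n ℂ)) (L * tower L N j) Us (Φ : TDir 4 n (L * tower L N j))))) 0 X X)
            = fderiv ℝ (fun y : ↥(skewSub 4 n N) => minAct 4 (sfClass 4 L N ε) L N (j + 1) (chart (ContinuousLinearMap.id ℝ (Matrix n n ℂ)) N V₀ (y : TDir 4 n N))) 0
                (fderiv ℝ (fderiv ℝ (strippedConstraint L N j Us)) 0 X X)) := by
  have hL1 : 1 ≤ L := le_trans (by norm_num) hL
  obtain ⟨ε₁, hε₁, T⟩ := thresholds (n := n) hL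
  obtain ⟨ε₂, hε₂, H⟩ := multiplier_transport_levelQ (n := n) hL
  refine ⟨min (ε₁ / 2) ε₂, lt_min (by positivity) hε₂, fun ε hε hεle hα3 hα4 hroom N _ hN => ?_⟩
  have hεε₁ : ε ≤ ε₁ := (hεle.trans (min_le_left _ _)).trans (by linarith)
  have h2ε : 2 * ε ≤ ε₁ := by linarith [hεle.trans (min_le_left _ _)]
  obtain ⟨-, -, hls, -⟩ := T ε hε hεε₁
  obtain ⟨-, -, hls2, -⟩ := T (2 * ε) (by positivity) h2ε
  obtain ⟨δV, hδV, hall⟩ := H ε hε (hεle.trans (min_le_right _ _)) N hN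
  refine ⟨δV, hδV, fun j V₀ hV₀ Us hUs => ?_⟩
  haveI : NeZero (L * tower L N j) := ⟨Nat.mul_ne_zero (NeZero.ne L) (tower_ne_zero L N j)⟩
  -- class facts for the minimiser
  have hUu : IsUnitaryCfg Us := hUs.mem.1.1
  have eP : ((N * L ^ (j + 1) : ℕ) : ℤ) = (L : ℤ) * (tower L N j : ℕ) := by rw [tower_eq]; push_cast; ring
  have hUP : IsPeriodicCfg Us ((L : ℤ) * (tower L N j : ℕ)) := by rw [← eP]; exact hUs.mem.1.2.1
  have hUa : SmallField Us (ε / ((L : ℝ) ^ (j + 1)) ^ 2) := hUs.mem.1.2.2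
  have hUsavg : cavgIter L (j + 1) Us = V₀ := by rw [cavgIter_eq_avgIter]; exact hUs.mem.2
  have hLp : 0 < (L : ℝ) ^ (j + 1) := by positivity
  have ha : 0 ≤ ε / ((L : ℝ) ^ (j + 1)) ^ 2 := by positivity
  have hax : ε / ((L : ℝ) ^ (j + 1)) ^ 2 < 2 * ε / ((L : ℝ) ^ (j + 1)) ^ 2 := by
    apply div_lt_div_of_pos_right _ (by positivity); linarith
  have hs2 : LevelSmall 4 L j (2 * ε / ((L : ℝ) ^ (j + 1)) ^ 2) := hls2 j
  have hα : 0 < 3 * ε := by positivity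
  have hxα : 2 * ε / ((L : ℝ) ^ (j + 1)) ^ 2 < 3 * ε * (((L : ℝ) ^ (j + 1))⁻¹) ^ 2 := by
    rw [inv_pow, ← div_eq_mul_inv]
    apply div_lt_div_of_pos_right _ (by positivity); linarith
  have h52 : B7Prop2Explicit.pdev Us < 3 * ε * (((L : ℝ) ^ (j + 1))⁻¹) ^ 2 :=
    (pdev_le_of_smallField ha hUa).trans_lt (hax.trans hxα)
  -- the three socket hypotheses, discharged for the stripped constraint
  have hΨ0 : strippedConstraint L N j Us 0 = 0 := strippedConstraint_zero L N j Us
  have hΨ2 : ContDiffAt ℝ 2 (strippedConstraint L N j Us) 0 := contDiffAt_strippedConstraint (N := N) hL j hUu hα hα3 hα4 h52 hroom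
  have heq := reduced_objective_eq_stripped_of_regime (N := N) (by norm_num) hL hε.le j (hls j) hUu hUP hUa ha hax hs2 hα hα3 hα4 hxα hroom
  rw [hUsavg] at heq
  obtain ⟨hi, hii⟩ := hall j V₀ hV₀ Us hUs (strippedConstraint L N j Us) hΨ0 hΨ2 heq
  refine ⟨hi, fun X hff => hii X ?_⟩
  -- on a top-frame-free direction the framed differential is the straight tower, which is `DΨ(0)`
  have hD := (hasFDerivAt_strippedConstraint (N := N) hL j hUu ha (hls j) hUa hα hα3 hα4 h52 hroom).fderiv
  rw [hD, qbarIterCLM_apply]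
  exact levelQ'_eq_skewPR_QbarIter_of_frameFree hL1 j hUu hUP ha (hls j) hUa X.2 hff

end

end Summit.QuantumFields.BalabanUV.T4Continuum.NE7MultiplierStrippedIdentity
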